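import Literature.NumberTheory.Sieve.ChenTheorem
import Literature.NumberTheory.LFunctions.RHWave0
import HarnessLib

/-!
# Explicit Chen and Rényi theorems: Bordignon–Johnston–Starichkova 2025, Johnston–Starichkova 2025,
# Bordignon–Starichkova 2024 — the printed consumers of the real-character exceptional-zero tables

Topic `Literature/NumberTheory/Sieve`; namespace `Literature.NumberTheory.Sieve` (beside
`ChenTheorem.lean`, whose vocabulary is reused: `Chen.singularSeries N = 𝔖(N) =
∏_{p>2}(1 - 1/(p-1)²) ∏_{p∣N, p>2}(p-1)/(p-2)`, the qualitative named fact `chen_goldbach`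
(parity.S12) of `ParityWave0.lean`, and Mathlib's `Nat.IsAtMostAlmostPrime k n` ("`n ≠ 0` has at
most `k` prime factors counted with multiplicity")). Typed by the cross-ladder literature-typing seat
`littype-FP2-1` (D-0088 (4) row (7): Platt 2016 / Platt–Trudgian 2021 / Booker 2006, «feeds the
conditionals column + instrument provenance») for the cell `parity-realchar`: these three recent,
refereed, fully explicit additive theorems are — by their authors' own account — CONSUMERS of exactly
the instrument facts that cell certifies, namely "no exceptional (Siegel) zero for real characters of
modulus `q ≤ Q`" (Platt 2016, `Literature.NumberTheory.LFunctions.platt2016_theorem71/72`, `Q = 4·10⁵`)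
and the explicit repulsion `β ≤ 1 - 100/(√q log² q)` beyond (Bordignon 2019/2020,
`Literature.NumberTheory.LFunctions.bordignon2019_theorem13` / `bordignon2020_theorem13`):

* Johnston–Starichkova, §2 (arXiv v3 l. 174): "Since there are no Siegel zeros for moduli less than
  `4·10⁵` [Platt 2016], we can also bound `β₀` by (strongbetabound) whenever `K_δ(x₁) ≤ 4·10⁵`";
  §6: "extending the computations of Platt [2016] regarding zeros of Dirichlet `L`-functions, would be
  a sure-fire way to improve the ingredients used for the unconditional result (Theorem 1.3)"; §6.2:
  "`β_q ≤ 1 - λ/(√q log² q)` … is an important component in the proof of Theorem 1.3. For `q > 4·10⁵`,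
  Bordignon shows that one can take `λ = 100` and this is what we use. Here, we note that for
  `q ≤ 4·10⁵` there are no Siegel zeros by a computation due to Platt. However, the relevant
  computation in [Platt 2016] was only a side result of the main computation, meaning a more targeted
  approach could pay dividends", with the footnote "In fact, through private correspondence, Platt and
  Trudgian claim to have shown that there are no Siegel zeros for `q ≤ 10⁹`. However, this work has yet
  to be published."; §1: "obtaining `K = 31` does not require the full-strength of GRH. Rather, if our
  knowledge of the zeros of Dirichlet `L`-functions were to improve (say with significant computation),
  then the unconditional result would approach the conditional one."
* Bordignon–Johnston–Starichkova, §9 (arXiv v6 l. 2737): "It therefore seems that the clearest way to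
  improve our result would be to improve on the Siegel zero bounds we used from [Bordignon 2019] and
  [Bordignon 2020]"; and (l. 2740) "it would be impossible [footnote: That is, unless some far-reaching
  result is proven, such as the non-existence of Siegel zeros] to prove Theorem 3 for
  `N ≥ exp(exp(22))`" with the present method.

## Sources (first-hand) and what is typed

* [BordignonJohnstonStarichkova2025] M. Bordignon, D. R. Johnston, V. Starichkova, *An explicit version
  of Chen's theorem and the linear sieve*, Int. J. Number Theory **21** (2025), no. 10, 2497–2572,
  doi:10.1142/S1793042125501192 — text read: arXiv:2207.09452**v6** (25 Jun 2025, the last version before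
  publication; single LaTeX source `Explicit_Chen_-_New.tex`, sha256 `626a6eea3c833c4e…`), whose global
  theorem counter gives: Theorem 3 (l. 272–281, label `Theo:B.`), Corollary 4 (l. 285–287, `distinctcor`),
  Theorem 5 (l. 291–294, `Theo:B1.`; superseded by [JohnstonStarichkova2025] Thm 1.3 and cited there as
  "[BJV22, Theorem 5]"), §9 "Proof of Theorem 3" (l. 2725–2745), §10 "Proof of Corollary 4 and
  Theorem 5" (l. 2747–2773). The journal abstract (Crossref) is the
  arXiv v6 abstract; the journal's internal numbering was not seen.
  - **Theorem 3** (verbatim): "Let `π₂(N)` denote the number of representations of a given even integer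
    `N` as the sum of a prime and a semi-prime. If `N > exp(exp(32.7))`, then
    `π₂(N) > 2·10⁻⁴ · U_N N / log² N`, where, with `γ` the Euler–Mclaurin [sic] constant,
    `U_N := 2 e^{-γ} ∏_{p>2} (1 - 1/(p-1)²) ∏_{p>2, p∣N} (p-1)/(p-2)`." Here "semi-prime" is the
    paper's §1 gloss "another number that is the product of at most two primes (a semi-prime)", and the
    proof of Corollary 4 (§10) shows that `η = 1` (the empty product) is counted: "consider
    representations of the form `N = p + η`, where `p` is prime and `η` has at most two prime factors.
    If `η` is not square-free there are two possible cases: either `η = 1`, or `η` has two identical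
    prime factors." → NAMED FACT `bordignonJohnstonStarichkova2025_theorem3` with
    `π₂(N) := #{p < N : p prime, N - p ≠ 0 has at most two prime factors}`
    (`ExplicitChen.primeP2RepCount`, Mathlib's `Nat.IsAtMostAlmostPrime 2`) and
    `U_N = 2e^{-γ} 𝔖(N)` (`ExplicitChen.bjsU`, on the tree's `Chen.singularSeries`).
  - **Corollary 4** (verbatim): "Every even integer `N > exp(exp(32.7))` can be represented as the sum
    of a prime and a square-free number with at most two prime factors." — PROVED here from Theorem 3
    along the printed §10 argument ("`π₂*(N) ≥ π₂(N) - 1 - √N > 2·10⁻⁴ U_N N/log² N - 1 - √N > 0`",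
    `π₂*` counting square-free `η > 1`): `bordignonJohnstonStarichkova2025_corollary4`
    (hypothesis `h : bordignonJohnstonStarichkova2025_theorem3`; conclusion with `1 < η`, `Squarefree η`
    as in the paper's `π₂*`).
* [JohnstonStarichkova2025] D. R. Johnston, V. V. Starichkova, *Some explicit results on the sum of a
  prime and an almost prime*, Acta Math. Hungar. **177** (2025), no. 1, 163–192,
  doi:10.1007/s10474-025-01572-w — text read: arXiv:2208.01229**v3** (11 Apr 2025; `main.tex` sha256
  `891ecd5fe85dc92c…`; theorems numbered within sections); the publisher's abstract (Springer, as
  served by Semantic Scholar) confirms the journal constants `395` and `31`. CAUTION: arXiv v1/v2 (and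
  the corpus copy `paper:arxiv-2208.01229` held on this hub) print `K = 369` and `K = 33`; the refereed
  values are `395` / `31`.
  - **Theorem 1.3** (verbatim, v3 l. 112–114): "Every even integer `N ≥ 4` can be written as the sum of
    a prime and a number with at most `K = 395` (not necessarily distinct) prime factors." → NAMED FACT
    `johnstonStarichkova2025_theorem13`.
  - **Theorem 1.4** (verbatim, v3 l. 116–118): "Assume GRH. Then every even integer `N ≥ 4` can be
    written as the sum of a prime and a number with at most `K = 31` (not necessarily distinct) prime
    factors." → NAMED FACT `johnstonStarichkova2025_theorem14`, an implication from the tree's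
    `Literature.NumberTheory.LFunctions.GeneralizedRiemannHypothesis` (RH for every Dirichlet
    `L`-function, open strip form = the paper's "Generalised Riemann Hypothesis").
* [BordignonStarichkova2024] M. Bordignon, V. Starichkova, *An explicit version of Chen's theorem
  assuming the Generalized Riemann Hypothesis*, Ramanujan J. **64** (2024), no. 4, 1213–1242,
  doi:10.1007/s11139-024-00866-x — text read: arXiv:2211.08844v1 (the only arXiv version; held as
  `paper:arxiv-2211.08844`), §1: "Theorem 3. Let `π₂(N)` denote the number of representations of a
  given even integer `N` as the sum of a prime number and a product of at most two prime factors. If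
  `N > exp(exp(15.85))`, then assuming GRH we have `π₂(N) > 4·10⁻⁴ U_N N/log² N` …" and "Corollary 1.
  Every even integer `N > exp(exp(15.85))` can be represented as the sum of a prime and a square-free
  number `η > 1` with at most two prime factors." The JOURNAL version sharpens the threshold: its
  abstract (publisher text) reads "assuming the Generalized Riemann Hypothesis every even integer larger
  than `exp(exp(14))` can be written as the sum of a prime number and a number that has at most two
  prime factors". The journal text is not held (want filed by the typing seat); typed here is the
  arXiv Corollary 1 under GRH with the WEAKER arXiv threshold `exp(exp(15.85))` — implied by the
  journal theorem, never stronger than either printed version → NAMED FACT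
  `bordignonStarichkova2024_corollary1`. `-- TODO(journal form): threshold exp(exp(14)) once the
  Ramanujan J. text is held.`

## Also proved here

* `chen_goldbach_of_bordignonJohnstonStarichkova2025` — the qualitative named fact `chen_goldbach`
  (parity.S12: every large even `N` is `p + m`, `Nat.IsAtMostAlmostPrime 2 m`) DERIVED from Theorem 3
  (via Corollary 4), i.e. from an explicit printed theorem with `N₀ = ⌈exp(exp(32.7))⌉ + 1`.
* `johnstonStarichkova2025_theorem13.renyi` — Rényi's 1948 theorem in the paper's wording of
  Theorem 1.1 ("There exists a natural number `K` such that every even integer `N ≥ 4` can be written as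
  the sum of a prime and a number with at most `K` prime factors"), from Theorem 1.3.
* `johnstonStarichkova2025_theorem13.mono` / `IsAtMostAlmostPrime` monotonicity bookkeeping, and the
  elementary counting lemma of BJS §10, `ExplicitChen.primeP2RepCount_le` (`π₂(N) ≤ π₂*(N) + √N + 2`,
  with `Nat.sqrt`).

Not typed: BJS Theorem 5 (`K = e^{29.3}`, superseded); BJS Theorem 6 (the explicit linear sieve) and
the explicit PNT-in-AP inputs (Bordignon 2021, Ernvall-Hytönen–Palojärvi) — other stories; the
quantitative BS Theorem 3 (its `U_N` is printed with `e^{+γ}` in arXiv v1 where BJS print `e^{-γ}`; only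
the existence corollary is typed).

## References

* [BordignonJohnstonStarichkova2025] Int. J. Number Theory 21 (2025) 2497–2572 = arXiv:2207.09452v6,
  Theorem 3, Corollary 4, §10.
* [JohnstonStarichkova2025] Acta Math. Hungar. 177 (2025) 163–192 = arXiv:2208.01229v3, Theorems 1.3,
  1.4, §2 (l. 174), §6.
* [BordignonStarichkova2024] Ramanujan J. 64 (2024) 1213–1242; arXiv:2211.08844v1 Theorem 3, Corollary 1.
* [Platt2016GRH] D. J. Platt, Math. Comp. 85 (2016) 3009–3027 (the cited Siegel-zero input, `q ≤ 4·10⁵`).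
* [Renyi1948] A. Rényi, Izv. Akad. Nauk SSSR Ser. Mat. 12 (1948) 57–78, Theorem 1.
-/

noncomputable section

open Real Finset ArithmeticFunction
open scoped Nat ArithmeticFunction.Omega

namespace Literature.NumberTheory.Sieve

namespace ExplicitChen

open Classical in
/-- BJS's `π₂(N)`: the number of representations `N = p + η` with `p` prime and `η ≥ 1` a product of at
most two primes (with multiplicity; `η = 1`, the empty product, is counted — BJS §10), rendered as
`#{p < N : p prime ∧ Nat.IsAtMostAlmostPrime 2 (N - p)}`.
[cite: BordignonJohnstonStarichkova2025, Theorem 3 and §10 (arXiv:2207.09452v6 l. 274, 2749–2754)] -/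
def primeP2RepCount (N : ℕ) : ℕ :=
  #((range N).filter fun p => p.Prime ∧ Nat.IsAtMostAlmostPrime 2 (N - p))

open Classical in
/-- BJS's `π₂*(N)` (§10): representations `N = p + η`, `p` prime, `η > 1` square-free with at most two
prime factors. [cite: BordignonJohnstonStarichkova2025, §10 (arXiv:2207.09452v6 l. 2749)] -/
def primeSqfreeP2RepCount (N : ℕ) : ℕ :=
  #((range N).filter fun p =>
    p.Prime ∧ Nat.IsAtMostAlmostPrime 2 (N - p) ∧ 1 < N - p ∧ Squarefree (N - p))

/-- BJS's `U_N := 2 e^{-γ} ∏_{p>2}(1 - 1/(p-1)²) ∏_{p>2, p∣N}(p-1)/(p-2) = 2 e^{-γ} 𝔖(N)` on the tree's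
`Chen.singularSeries`. [cite: BordignonJohnstonStarichkova2025, Theorem 3 (arXiv:2207.09452v6 l. 279)] -/
def bjsU (N : ℕ) : ℝ :=
  2 * Real.exp (-Real.eulerMascheroniConstant) * Chen.singularSeries N

end ExplicitChen

open ExplicitChen

/-! ### The named facts -/

/-- **Bordignon–Johnston–Starichkova 2025, Theorem 3 (explicit Chen, quantitative; NAMED FACT, as
printed in arXiv v6 = IJNT 21 (2025)).** "Let `π₂(N)` denote the number of representations of a given
even integer `N` as the sum of a prime and a semi-prime [§1: a product of at most two primes]. If
`N > exp(exp(32.7))`, then `π₂(N) > 2·10⁻⁴ · U_N N/log² N`, where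
`U_N := 2e^{-γ} ∏_{p>2}(1 - 1/(p-1)²) ∏_{p>2, p∣N}(p-1)/(p-2)`." An explicit linear sieve + explicit PNT in
arithmetic progressions with the exceptional-zero inputs of Platt 2016 (`q ≤ 4·10⁵`), Bordignon
2019/2020 (`λ = 100`) and Kadiri's `R₁`; not re-proved here. Users take
`(h : bordignonJohnstonStarichkova2025_theorem3)`.
[cite: BordignonJohnstonStarichkova2025, Theorem 3 (arXiv:2207.09452v6 l. 272–281; IJNT 21 (2025) 2497–2572)] -/
def bordignonJohnstonStarichkova2025_theorem3 : Prop :=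
  ∀ N : ℕ, Even N → Real.exp (Real.exp 32.7) < N →
    2e-4 * bjsU N * N / Real.log N ^ 2 < (primeP2RepCount N : ℝ)

/-- **Johnston–Starichkova 2025, Theorem 1.3 (explicit Rényi; NAMED FACT, as printed in the refereed
version).** "Every even integer `N ≥ 4` can be written as the sum of a prime and a number with at most
`K = 395` (not necessarily distinct) prime factors." (arXiv v1–v2 print `369`; Acta Math. Hungar. and
arXiv v3 print `395`.) Not re-proved here. [cite: JohnstonStarichkova2025, Theorem 1.3 (Acta Math. Hungar. 177 (2025) 163–192; arXiv:2208.01229v3 l. 112–114)] -/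
def johnstonStarichkova2025_theorem13 : Prop :=
  ∀ N : ℕ, Even N → 4 ≤ N → ∃ p m : ℕ, p.Prime ∧ Nat.IsAtMostAlmostPrime 395 m ∧ p + m = N

/-- **Johnston–Starichkova 2025, Theorem 1.4 (explicit Rényi under GRH; NAMED FACT, as printed in the
refereed version).** "Assume GRH. Then every even integer `N ≥ 4` can be written as the sum of a prime
and a number with at most `K = 31` (not necessarily distinct) prime factors." (arXiv v1–v2: `33`.) GRH =
the Riemann hypothesis for every Dirichlet `L`-function, the tree's
`Literature.NumberTheory.LFunctions.GeneralizedRiemannHypothesis`. "It should be noted that obtaining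
`K = 31` does not require the full-strength of GRH. Rather, if our knowledge of the zeros of Dirichlet
`L`-functions were to improve (say with significant computation), then the unconditional result would
approach the conditional one." Not re-proved here.
[cite: JohnstonStarichkova2025, Theorem 1.4 (Acta Math. Hungar. 177 (2025) 163–192; arXiv:2208.01229v3 l. 116–119)] -/
def johnstonStarichkova2025_theorem14 : Prop :=
  Literature.NumberTheory.LFunctions.GeneralizedRiemannHypothesis →
    ∀ N : ℕ, Even N → 4 ≤ N → ∃ p m : ℕ, p.Prime ∧ Nat.IsAtMostAlmostPrime 31 m ∧ p + m = N

/-- **Bordignon–Starichkova 2024, Corollary 1 under GRH (explicit Chen under GRH; NAMED FACT).** arXiv v1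
(the text read): "Corollary 1. Every even integer `N > exp(exp(15.85))` can be represented as the sum of
a prime and a square-free number `η > 1` with at most two prime factors" (from Theorem 3, "assuming
GRH"). The refereed version (Ramanujan J. 64 (2024) 1213–1242; text not held) has the SHARPER threshold
`exp(exp(14))` (publisher's abstract: "assuming the Generalized Riemann Hypothesis every even integer
larger than `exp(exp(14))` can be written as the sum of a prime number and a number that has at most
two prime factors"); the arXiv threshold typed here is implied by it.
`-- TODO(journal form): exp(exp(14)) once the journal text is held.`
[cite: BordignonStarichkova2024, Corollary 1 with Theorem 3 (arXiv:2211.08844v1 §1); journal abstract (Ramanujan J. 64 (2024))] -/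
def bordignonStarichkova2024_corollary1 : Prop :=
  Literature.NumberTheory.LFunctions.GeneralizedRiemannHypothesis →
    ∀ N : ℕ, Even N → Real.exp (Real.exp 15.85) < N →
      ∃ p η : ℕ, p.Prime ∧ 1 < η ∧ Squarefree η ∧ Nat.IsAtMostAlmostPrime 2 η ∧ p + η = N

/-! ### BJS §10: Corollary 4 from Theorem 3 (proved) -/

namespace ExplicitChen

/-- A nonzero integer with at most two prime factors which is not square-free is the square of a prime
(the case analysis of BJS §10: "either `η = 1`, or `η` has two identical prime factors").
[cite: BordignonJohnstonStarichkova2025, §10 (arXiv:2207.09452v6 l. 2754–2758)] -/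
theorem eq_prime_sq_of_not_squarefree {n : ℕ} (h2 : Nat.IsAtMostAlmostPrime 2 n)
    (hsq : ¬Squarefree n) : ∃ q : ℕ, q.Prime ∧ n = q ^ 2 := by
  obtain ⟨hn0, hΩ⟩ := h2
  rw [Nat.squarefree_iff_prime_squarefree] at hsq
  push Not at hsq
  obtain ⟨q, hq, hqn⟩ := hsq
  obtain ⟨u, rfl⟩ := hqn
  have hu0 : u ≠ 0 := by rintro rfl; simp at hn0
  have hqq0 : q * q ≠ 0 := mul_ne_zero hq.ne_zero hq.ne_zero
  have hΩqq : Ω (q * q) = 2 := by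
    rw [cardFactors_mul hq.ne_zero hq.ne_zero, cardFactors_apply_prime hq]
  have hΩu : Ω u = 0 := by
    have := cardFactors_mul hqq0 hu0
    omega
  rcases (cardFactors_eq_zero_iff_eq_zero_or_one).mp hΩu with h | h
  · exact absurd h hu0
  · exact ⟨q, hq, by rw [h]; ring⟩

/-- **BJS §10, the counting step** "`π₂*(N) ≥ π₂(N) - 1 - √N`": the representations `N = p + η` counted by
`π₂` but not by `π₂*` have `η = 1` (at most one) or `η = q²` with `q` prime, `q ≤ √N` (at most `√N + 1`
of them). [cite: BordignonJohnstonStarichkova2025, §10 (arXiv:2207.09452v6 l. 2756–2760)] -/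
theorem primeP2RepCount_le (N : ℕ) :
    primeP2RepCount N ≤ primeSqfreeP2RepCount N + (Nat.sqrt N + 2) := by
  classical
  unfold primeP2RepCount primeSqfreeP2RepCount
  set S := (range N).filter fun p => p.Prime ∧ Nat.IsAtMostAlmostPrime 2 (N - p) with hS
  set good : ℕ → Prop := fun p => 1 < N - p ∧ Squarefree (N - p) with hgood
  have hT : ((range N).filter fun p =>
      p.Prime ∧ Nat.IsAtMostAlmostPrime 2 (N - p) ∧ 1 < N - p ∧ Squarefree (N - p)) =
      S.filter good := by
    ext p; simp [hS, hgood, and_assoc]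
  rw [hT, ← card_filter_add_card_filter_not (s := S) good]
  gcongr
  -- the bad part: `B = {p ∈ S : ¬ good p} ⊆ {N - 1} ∪ {p ∈ S : N - p = q², q prime}`
  set B := S.filter fun p => ¬good p with hB
  have hsplit : B ⊆ insert (N - 1) (B.filter fun p => 1 < N - p) := by
    intro p hp
    rw [mem_insert, mem_filter]
    by_cases h1 : 1 < N - p
    · exact Or.inr ⟨hp, h1⟩
    · left
      have hpS : p ∈ S := (mem_filter.mp hp).1
      have hpN : p < N := mem_range.mp (mem_filter.mp hpS).1
      omega
  have hinj : Set.InjOn (fun p => Nat.sqrt (N - p)) ↑(B.filter fun p => 1 < N - p) := by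
    intro p₁ hp₁ p₂ hp₂ heq
    simp only [coe_filter, Set.mem_setOf_eq, hB, hS, mem_filter, mem_range, hgood] at hp₁ hp₂
    obtain ⟨⟨⟨hp₁N, -, hap₁⟩, hng₁⟩, h1₁⟩ := hp₁
    obtain ⟨⟨⟨hp₂N, -, hap₂⟩, hng₂⟩, h1₂⟩ := hp₂
    have hsq₁ : ¬Squarefree (N - p₁) := fun h => hng₁ ⟨h1₁, h⟩
    have hsq₂ : ¬Squarefree (N - p₂) := fun h => hng₂ ⟨h1₂, h⟩
    obtain ⟨q₁, -, hq₁⟩ := eq_prime_sq_of_not_squarefree hap₁ hsq₁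
    obtain ⟨q₂, -, hq₂⟩ := eq_prime_sq_of_not_squarefree hap₂ hsq₂
    have e₁ : Nat.sqrt (N - p₁) = q₁ := by rw [hq₁, pow_two, Nat.sqrt_eq]
    have e₂ : Nat.sqrt (N - p₂) = q₂ := by rw [hq₂, pow_two, Nat.sqrt_eq]
    have hq : q₁ = q₂ := by simpa [e₁, e₂] using heq
    have : N - p₁ = N - p₂ := by rw [hq₁, hq₂, hq]
    omega
  have himg : ∀ p ∈ B.filter (fun p => 1 < N - p), Nat.sqrt (N - p) ∈ range (Nat.sqrt N + 1) := by
    intro p _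
    exact mem_range.mpr (Nat.lt_succ_of_le (Nat.sqrt_le_sqrt (Nat.sub_le N p)))
  calc #B ≤ #(insert (N - 1) (B.filter fun p => 1 < N - p)) := card_le_card hsplit
    _ ≤ #(B.filter fun p => 1 < N - p) + 1 := card_insert_le _ _
    _ ≤ #(range (Nat.sqrt N + 1)) + 1 :=
        Nat.add_le_add_right (card_le_card_of_injOn _ himg hinj) 1
    _ = Nat.sqrt N + 2 := by simp

/-- `U_N ≥ 1/2`: `U_N = 2e^{-γ}𝔖(N) ≥ 2 e^{-γ} C₂ ≥ e^{-γ} > e^{-2/3} > 1/2` (tree: `½ ≤ C₂ ≤ 𝔖(N)`,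
Mathlib: `γ < 2/3`, `0.6931 < log 2`) — the lower bound for `U_N` implicit in the last inequality
"`> 0`" of BJS §10. [cite: BordignonJohnstonStarichkova2025, §10 (arXiv:2207.09452v6 l. 2760, the inequality `2·10⁻⁴ U_N N/log² N − 1 − √N > 0`)] -/
theorem half_le_bjsU (N : ℕ) : 1 / 2 ≤ bjsU N := by
  have hS : 1 / 2 ≤ Chen.singularSeries N :=
    half_le_twinPrimeConst.trans (Chen.twinPrimeConst_le_singularSeries N)
  have hγ : Real.exp (-Real.eulerMascheroniConstant) ≥ 1 / 2 := by
    have h1 : -Real.eulerMascheroniConstant ≥ -(2 / 3) := by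
      linarith [Real.eulerMascheroniConstant_lt_two_thirds]
    have h2 : Real.exp (-(2 / 3 : ℝ)) ≥ 1 / 2 := by
      rw [ge_iff_le, ← Real.log_le_iff_le_exp (by norm_num)]
      have := Real.log_two_gt_d9
      have : Real.log (1 / 2 : ℝ) = -Real.log 2 := by
        rw [one_div, Real.log_inv]
      linarith
    exact le_trans h2 (Real.exp_le_exp.mpr h1)
  unfold bjsU
  nlinarith

/-- The numerical tail of BJS §10 ("`2·10⁻⁴ U_N N/log² N − 1 − √N > 0`" for `N > exp(exp(32.7))`), in
the form `10⁻⁴ · N/log² N > √N + 2` (by an astronomical margin; we use `e^{L/2} ≥ L³/48` with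
`L = log N > e^{32.7} > 2.7¹⁴ > 4.8·10⁵`). [cite: BordignonJohnstonStarichkova2025, §10 (arXiv:2207.09452v6 l. 2760)] -/
theorem sqrt_add_two_lt (N : ℕ) (hN : Real.exp (Real.exp 32.7) < N) :
    (Nat.sqrt N : ℝ) + 2 < 1e-4 * N / Real.log N ^ 2 := by
  have hN0 : (0 : ℝ) < N := lt_trans (Real.exp_pos _) hN
  set L := Real.log N with hL
  have hNL : (N : ℝ) = Real.exp L := by rw [hL, Real.exp_log hN0]
  have hLbig : Real.exp 32.7 < L := by
    rw [hL, Real.lt_log_iff_exp_lt hN0]; exact hN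
  have h14 : (480048 : ℝ) < L := by
    have h1 : (2.7 : ℝ) < Real.exp 1 := lt_trans (by norm_num) Real.exp_one_gt_d9
    have h2 : (2.7 : ℝ) ^ 14 < Real.exp 1 ^ 14 := by gcongr
    have h3 : Real.exp 1 ^ 14 = Real.exp 14 := by rw [← Real.exp_nat_mul]; norm_num
    have h4 : Real.exp 14 ≤ Real.exp 32.7 := Real.exp_le_exp.mpr (by norm_num)
    nlinarith [show (480048 : ℝ) < 2.7 ^ 14 by norm_num]
  have hLpos : 0 < L := by linarith
  -- `e^{L/2} ≥ (L/2)³/3! = L³/48`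
  have hE : L ^ 3 / 48 ≤ Real.exp (L / 2) := by
    have := Real.pow_div_factorial_le_exp (L / 2) (by positivity) 3
    have h6 : ((3 ! : ℕ) : ℝ) = 6 := by norm_num [Nat.factorial]
    rw [h6] at this
    convert this using 1
    ring
  have hE0 : 0 < Real.exp (L / 2) := Real.exp_pos _
  have hsqrt : (Nat.sqrt N : ℝ) ≤ Real.exp (L / 2) := by
    have h1 : (Nat.sqrt N : ℝ) ≤ Real.sqrt N := Real.nat_sqrt_le_real_sqrt
    have h2 : Real.sqrt (N : ℝ) = Real.exp (L / 2) := by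
      rw [hNL, show Real.exp L = Real.exp (L / 2) * Real.exp (L / 2) by
        rw [← Real.exp_add]; ring_nf, Real.sqrt_mul_self hE0.le]
    linarith
  -- main estimate: `1e-4 · e^L / L² = 1e-4 · e^{L/2} · (e^{L/2}/L²) ≥ 1e-4 · e^{L/2} · L/48`
  have hNexp : (N : ℝ) = Real.exp (L / 2) * Real.exp (L / 2) := by
    rw [hNL, ← Real.exp_add]; ring_nf
  rw [hNexp, lt_div_iff₀ (by positivity)]
  -- want: (sqrt N + 2) L² < 1e-4 e^{L/2} e^{L/2}
  have hA : Real.exp (L / 2) * L ^ 2 * 10001 ≤ Real.exp (L / 2) * (L ^ 3 / 48) := by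
    have : L ^ 2 * 10001 ≤ L ^ 3 / 48 := by nlinarith [sq_nonneg L, hLpos]
    nlinarith
  have hB : (2 : ℝ) * L ^ 2 ≤ Real.exp (L / 2) := by
    -- `2 L² ≤ L³/48` as `L ≥ 96`
    have : (2 : ℝ) * L ^ 2 ≤ L ^ 3 / 48 := by nlinarith [sq_nonneg L, hLpos]
    linarith
  nlinarith [mul_le_mul_of_nonneg_right hE hE0.le, sq_nonneg L, hsqrt,
    mul_nonneg hE0.le (sq_nonneg L)]

end ExplicitChen

/-- **Bordignon–Johnston–Starichkova 2025, Corollary 4 — PROVED from Theorem 3** along the printed §10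
argument: "Every even integer `N > exp(exp(32.7))` can be represented as the sum of a prime and a
square-free number with at most two prime factors" (the paper's `π₂*` counts square-free `η > 1`; so
does the conclusion here). [cite: BordignonJohnstonStarichkova2025, Corollary 4 and §10 (arXiv:2207.09452v6 l. 285–287, 2749–2762)] -/
theorem bordignonJohnstonStarichkova2025_corollary4 (h : bordignonJohnstonStarichkova2025_theorem3)
    (N : ℕ) (hN : Even N) (hbig : Real.exp (Real.exp 32.7) < N) :
    ∃ p η : ℕ, p.Prime ∧ 1 < η ∧ Squarefree η ∧ Nat.IsAtMostAlmostPrime 2 η ∧ p + η = N := by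
  classical
  have h3 := h N hN hbig
  have hU := ExplicitChen.half_le_bjsU N
  have hnum := ExplicitChen.sqrt_add_two_lt N hbig
  have hle := ExplicitChen.primeP2RepCount_le N
  have hN0 : (0 : ℝ) < N := lt_trans (Real.exp_pos _) hbig
  have hlog : 0 < Real.log N ^ 2 := by
    have : 1 < (N : ℝ) := by
      have : (1 : ℝ) < Real.exp (Real.exp 32.7) := Real.one_lt_exp_iff.mpr (Real.exp_pos _)
      linarith
    have := Real.log_pos this
    positivity
  -- `π₂(N) > 2e-4 · U_N · N/log² N ≥ 1e-4 · N/log² N > √N + 2`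
  have hπ : (Nat.sqrt N : ℝ) + 2 < (primeP2RepCount N : ℝ) := by
    have h1 : 1e-4 * (N : ℝ) / Real.log N ^ 2 ≤ 2e-4 * bjsU N * N / Real.log N ^ 2 := by
      rw [div_le_div_iff_of_pos_right hlog]
      nlinarith
    linarith
  have hpos : 0 < primeSqfreeP2RepCount N := by
    have : (Nat.sqrt N + 2 : ℕ) < primeP2RepCount N := by exact_mod_cast hπ
    omega
  obtain ⟨p, hp⟩ := Finset.card_pos.mp hpos
  simp only [mem_filter, mem_range] at hp
  obtain ⟨hpN, hpp, hap, h1, hsq⟩ := hp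
  exact ⟨p, N - p, hpp, h1, hsq, hap, by omega⟩

/-- **`chen_goldbach` (parity.S12, the qualitative Chen theorem of `ParityWave0.lean`) DERIVED from the
explicit theorem of Bordignon–Johnston–Starichkova**, with `N₀ = ⌈exp(exp(32.7))⌉₊ + 1`.
[cite: BordignonJohnstonStarichkova2025, Corollary 4 (arXiv:2207.09452v6 l. 285–287)] -/
theorem chen_goldbach_of_bordignonJohnstonStarichkova2025
    (h : bordignonJohnstonStarichkova2025_theorem3) : chen_goldbach := by
  refine ⟨⌈Real.exp (Real.exp 32.7)⌉₊ + 1, fun N hN0 hN => ?_⟩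
  have hbig : Real.exp (Real.exp 32.7) < N := by
    have := Nat.le_ceil (Real.exp (Real.exp 32.7))
    have h' : (⌈Real.exp (Real.exp 32.7)⌉₊ : ℝ) + 1 ≤ N := by exact_mod_cast hN0
    linarith
  obtain ⟨p, η, hp, -, -, hη, hsum⟩ := bordignonJohnstonStarichkova2025_corollary4 h N hN hbig
  exact ⟨p, η, hp, hη, hsum⟩

/-- Monotonicity in `K` of the Rényi-type statement "`N` is the sum of a prime and a number with at
most `K` prime factors" (the form of [JohnstonStarichkova2025] Theorem 1.1). [cite: JohnstonStarichkova2025, Theorem 1.1 (arXiv:2208.01229v3 l. 98–101)] -/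
theorem exists_prime_add_isAtMostAlmostPrime_mono {K K' N : ℕ} (hKK' : K ≤ K')
    (h : ∃ p m : ℕ, p.Prime ∧ Nat.IsAtMostAlmostPrime K m ∧ p + m = N) :
    ∃ p m : ℕ, p.Prime ∧ Nat.IsAtMostAlmostPrime K' m ∧ p + m = N := by
  obtain ⟨p, m, hp, ⟨hm0, hm⟩, hs⟩ := h
  exact ⟨p, m, hp, ⟨hm0, hm.trans hKK'⟩, hs⟩

/-- **Rényi's theorem (1948) in Johnston–Starichkova's wording of their Theorem 1.1** — "There exists a
natural number `K` such that every even integer `N ≥ 4` can be written as the sum of a prime and a number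
with at most `K` prime factors" — DERIVED from Theorem 1.3 (`K = 395`).
[cite: JohnstonStarichkova2025, Theorem 1.1 (= [Renyi1948, Theorem 1]) and Theorem 1.3] -/
theorem johnstonStarichkova2025_theorem13.renyi (h : johnstonStarichkova2025_theorem13) :
    ∃ K : ℕ, ∀ N : ℕ, Even N → 4 ≤ N →
      ∃ p m : ℕ, p.Prime ∧ Nat.IsAtMostAlmostPrime K m ∧ p + m = N :=
  ⟨395, h⟩

/-- Theorem 1.3 with any `K ≥ 395`. [cite: JohnstonStarichkova2025, Theorem 1.3] -/
theorem johnstonStarichkova2025_theorem13.mono (h : johnstonStarichkova2025_theorem13) {K : ℕ}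
    (hK : 395 ≤ K) (N : ℕ) (hN : Even N) (h4 : 4 ≤ N) :
    ∃ p m : ℕ, p.Prime ∧ Nat.IsAtMostAlmostPrime K m ∧ p + m = N :=
  exists_prime_add_isAtMostAlmostPrime_mono hK (h N hN h4)

/-- Under GRH, Theorem 1.4 gives every `K ≥ 31`; in particular it implies the unconditional shape of
Theorem 1.3. [cite: JohnstonStarichkova2025, Theorems 1.3–1.4] -/
theorem johnstonStarichkova2025_theorem14.theorem13_shape (h : johnstonStarichkova2025_theorem14)
    (hGRH : Literature.NumberTheory.LFunctions.GeneralizedRiemannHypothesis) :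
    johnstonStarichkova2025_theorem13 :=
  fun N hN h4 => exists_prime_add_isAtMostAlmostPrime_mono (by norm_num) (h hGRH N hN h4)

/-- Under GRH, Bordignon–Starichkova's corollary yields the `chen_goldbach` shape beyond `exp(exp(15.85))`.
[cite: BordignonStarichkova2024, Corollary 1 (arXiv:2211.08844v1)] -/
theorem bordignonStarichkova2024_corollary1.isAtMostAlmostPrime (h : bordignonStarichkova2024_corollary1)
    (hGRH : Literature.NumberTheory.LFunctions.GeneralizedRiemannHypothesis) (N : ℕ) (hN : Even N)
    (hbig : Real.exp (Real.exp 15.85) < N) :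
    ∃ p m : ℕ, p.Prime ∧ Nat.IsAtMostAlmostPrime 2 m ∧ p + m = N := by
  obtain ⟨p, η, hp, -, -, hη, hs⟩ := h hGRH N hN hbig
  exact ⟨p, η, hp, hη, hs⟩

end Literature.NumberTheory.Sieve
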